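import Summits.AnomalousDissipation.AnomalousDissipation.Theses.ForcedSmallScales
import Summits.AnomalousDissipation.AnomalousDissipation.Theses.TameRoughRigidity
import Summits.AnomalousDissipation.AnomalousDissipation.Theorems.TameRoughRigidityGPOrientationBridge
import Summits.AnomalousDissipation.AnomalousDissipation.Theorems.EnsembleRigidityGPStatisticalRigidityGpSmallEnergy
import Summits.AnomalousDissipation.AnomalousDissipation.Theorems.GPEulerCoercive.Negative.RestState

/-!
# Crux-strategist census sketch — `ForcedSmallScales.CoerciveForceExists` (stmt-AnomalousDissipation-1434)

Seat `planner-cstrat-stmt-AnomalousDissipation-1434-r1-0` (REDIRECT strategist r1, 2026-08-17).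
Backing Lean for `STRATEGY-CENSUS.md` (same crux directory).  Everything here is sorry-free.

Contents
* `IsCoercive f` — the crux's predicate ("f is H¹-coercive": no FMRT stationary statistical solution of
  f-forced Euler), and `coerciveForceExists_iff` (the crux is `∃ f admissible, f ≠ 0, IsCoercive f`).
* DOMINATION by the live pinned sibling crux `TameRoughRigidity.GPEulerCoercive` (stmt-18400, "N"):
  `coerciveForceExists_of_gpEulerCoercive : N → C` (witness `f = f_GP`), and through the LANDED orientation
  bridge (stmt-18404) `cyclicForceCoercive_iff_gpEulerCoercive : CyclicForceCoercive ↔ N`, hence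
  `coerciveForceExists_of_cyclicForceCoercive : CyclicForceCoercive → C` (this route's support 1440 ⇒ crux 1434).
* NEGATION bookkeeping: `universalDodgers_iff_not_coerciveForceExists : UniversalDodgers ↔ ¬ C`
  (the route docstring's claim; `f = 0` is carried by the rest statistics, landed `isStationaryStatisticalSolution_rest`).
* DECOMPOSITION candidates, typed, with their (trivial) assemblies PROVED — recorded to show which piece
  remains the whole crux (see the census §Decomposition): `isCoercive_of_static` (enemy-class split),
  `isCoercive_of_tail` (moment/tail split).  Neither is filed: the census explains why.
-/

set_option linter.dupNamespace false

noncomputable section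

open MeasureTheory
open scoped InnerProductSpace ENNReal
open Literature.Analysis.FunctionSpaces Literature.Analysis.FluidPDE

namespace Summit.AnomalousDissipation.AnomalousDissipation.Cruxes.CoerciveForceExists.Strategist

open Summit.AnomalousDissipation.AnomalousDissipation.Theses
open Summit.AnomalousDissipation.AnomalousDissipation.Theorems.EnsembleRigidity (gpForce gpForce_eq)
open Summit.AnomalousDissipation.AnomalousDissipation.Theorems.EnsembleRigidity.GPStatisticalRigidity
  (gpForce_integral_inner_self)
open Summit.AnomalousDissipation.AnomalousDissipation.Theorems.SteadyStatesLoudBounded.GpAdmissible (stub_gpAdmissible)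
open Summit.AnomalousDissipation.AnomalousDissipation.Theorems.TameRoughRigidity (gpOrientationBridge_proof)
open Summit.AnomalousDissipation.AnomalousDissipation.Theorems.GPEulerCoercive.Negative
  (isStationaryStatisticalSolution_rest isSmooth_zero isDivFree_zero hasZeroMean_zero)

local notation "Vec3" => (UnitAddTorus (Fin 3) → EuclideanSpace ℝ (Fin 3))
local notation "L2" => (Lp (EuclideanSpace ℝ (Fin 3)) 2 (volume : Measure (UnitAddTorus (Fin 3))))
local notation "H3" => (Torus.energySpace (Fin 3))

/-! ## The predicate and the crux -/

/-- `f` is **H¹-coercive**: no Borel probability measure on `H` of finite mean enstrophy is a stationary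
statistical solution (FMRT class, `ν = 0`) of the Euler equations forced by `f`. -/
def IsCoercive (f : Vec3) : Prop :=
  ∀ μ : Measure H3, ¬ Torus.IsStationaryStatisticalSolution 0 f μ

/-- The crux, through `IsCoercive` (definitional). -/
theorem coerciveForceExists_iff :
    ForcedSmallScales.CoerciveForceExists ↔
      ∃ f : Vec3, Torus.IsSmooth f ∧ Torus.IsDivFree f ∧ Torus.HasZeroMean f ∧ f ≠ 0 ∧ IsCoercive f :=
  Iff.rfl

/-! ## Domination by the pinned sibling crux N = `TameRoughRigidity.GPEulerCoercive` (stmt-18400) -/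

/-- `f_GP ≠ 0`: its `L²` norm squared is `3/2` (landed `gpForce_integral_inner_self`). -/
theorem gpForce_ne_zero : gpForce ≠ 0 := by
  intro h
  have h32 := gpForce_integral_inner_self
  rw [h] at h32
  norm_num at h32

/-- **Domination.** `N → C`: the Galloway–Proctor force is an admissible nonzero witness
(landed `stub_gpAdmissible`, `gpForce_ne_zero`). -/
theorem coerciveForceExists_of_gpEulerCoercive (hN : TameRoughRigidity.GPEulerCoercive) :
    ForcedSmallScales.CoerciveForceExists := by
  obtain ⟨hs, hd, hz⟩ := stub_gpAdmissible
  exact ⟨gpForce, hs, hd, hz, gpForce_ne_zero, fun μ => hN gpForce gpForce_eq μ⟩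

/-- This route's support item `CyclicForceCoercive` (stmt-1440) **is** `N` up to the lattice isometry
`x₁ ↔ x₂` — the LANDED orientation bridge `gpOrientationBridge_proof` (stmt-18404), definitionally. -/
theorem cyclicForceCoercive_iff_gpEulerCoercive :
    ForcedSmallScales.CyclicForceCoercive ↔ TameRoughRigidity.GPEulerCoercive :=
  gpOrientationBridge_proof

/-- `1440 ⇒ 1434` (the route docstring's "proving it proves crux #2", now a theorem). -/
theorem coerciveForceExists_of_cyclicForceCoercive (h : ForcedSmallScales.CyclicForceCoercive) :
    ForcedSmallScales.CoerciveForceExists :=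
  coerciveForceExists_of_gpEulerCoercive (cyclicForceCoercive_iff_gpEulerCoercive.mp h)

/-! ## Negation bookkeeping: `UniversalDodgers ↔ ¬ CoerciveForceExists` -/

/-- The negative item (stmt-1437) is exactly the negation of the crux: `→` is immediate; for `←`, the only
admissible force not covered by `¬ C` is `f = 0`, carried by the rest statistics `δ₀`
(landed `isStationaryStatisticalSolution_rest`). -/
theorem universalDodgers_iff_not_coerciveForceExists :
    ForcedSmallScales.UniversalDodgers ↔ ¬ ForcedSmallScales.CoerciveForceExists := by
  constructor
  · rintro h ⟨f, hs, hd, hz, -, hco⟩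
    obtain ⟨μ, hμ⟩ := h f hs hd hz
    exact hco μ hμ
  · intro h f hs hd hz
    by_cases hf : f = 0
    · subst hf
      exact ⟨_, isStationaryStatisticalSolution_rest⟩
    · by_contra hno
      exact h ⟨f, hs, hd, hz, hf, fun μ hμ => hno ⟨μ, hμ⟩⟩

/-! ## Decomposition candidates (typed; assemblies proved; NOT filed — see census §Decomposition) -/

/-- (D-enemy, piece X₁) **Static reduction**: every finite-enstrophy Euler statistics of `f` yields a
finite-enstrophy STEADY weak Euler state of `f`.  False in kind (orbit measures of time-periodic forced-Euler
motions are stationary statistics not carried by steady states) and without any proof technology. -/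
def StaticReduction (f : Vec3) : Prop :=
  (∃ μ : Measure H3, Torus.IsStationaryStatisticalSolution 0 f μ) →
    ∃ v : H3, ((v : L2) ∈ Torus.energySpaceV (Fin 3)) ∧ Torus.IsSteadyWeakSolution 0 f v

/-- (D-enemy, piece X₂) **No finite-enstrophy steady state**: the `H¹` shadow of the crux pinned at `f`
(implies the smooth-steady coercivity question, open in print in both directions). -/
def NoSteadyState (f : Vec3) : Prop :=
  ∀ v : H3, ((v : L2) ∈ Torus.energySpaceV (Fin 3)) → ¬ Torus.IsSteadyWeakSolution 0 f v

/-- Assembly of the enemy-class split (trivial seam). -/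
theorem isCoercive_of_static (f : Vec3) (h₁ : StaticReduction f) (h₂ : NoSteadyState f) : IsCoercive f := by
  intro μ hμ
  obtain ⟨v, hv, hsteady⟩ := h₁ ⟨μ, hμ⟩
  exact h₂ v hv hsteady

/-- (D-tail, piece Y₁) **Tail reduction**: a dodger of `f` can be traded for one carried by an energy ball.
No mechanism at `ν = 0` (no dissipation, no absorbing ball; conditioning destroys stationarity). -/
def TailReduction (f : Vec3) : Prop :=
  (∃ μ : Measure H3, Torus.IsStationaryStatisticalSolution 0 f μ) →
    ∃ (μ : Measure H3) (E : ℝ), Torus.IsStationaryStatisticalSolution 0 f μ ∧ μ {u : H3 | E < ‖u‖ ^ 2} = 0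

/-- (D-tail, piece Y₂) **No ball-carried statistics** — the weaker coercivity the route actually consumes
(EnstrophyDichotomy's limit measures are carried by an energy ball); still the whole difficulty. -/
def NoBallCarriedSSS (f : Vec3) : Prop :=
  ∀ (μ : Measure H3) (E : ℝ), μ {u : H3 | E < ‖u‖ ^ 2} = 0 → ¬ Torus.IsStationaryStatisticalSolution 0 f μ

/-- Assembly of the tail split (trivial seam). -/
theorem isCoercive_of_tail (f : Vec3) (h₁ : TailReduction f) (h₂ : NoBallCarriedSSS f) : IsCoercive f := by
  intro μ hμ
  obtain ⟨μ', E, hμ', hball⟩ := h₁ ⟨μ, hμ⟩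
  exact h₂ μ' E hball hμ'

/-- `IsCoercive` is monotone along these pieces in the expected direction: coercive ⇒ no ball-carried
statistics and ⇒ no finite-enstrophy steady state would need the Dirac lemma; we record only the
definitional one. -/
theorem noBallCarriedSSS_of_isCoercive (f : Vec3) (h : IsCoercive f) : NoBallCarriedSSS f :=
  fun μ _ _ hμ => h μ hμ

end Summit.AnomalousDissipation.AnomalousDissipation.Cruxes.CoerciveForceExists.Strategist

end
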